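import Summits.AtomisticToContinuum.Crystallization.Theorems.PricedLinkCensusStackingHingeUnmatchedNearBadBond
import Literature.MathematicalPhysics.StatisticalMechanics.HcpHomogeneous

/-!
# Crux `HcpLandscapeGap` (route `HullExactificationCascade`, stmt-AtomisticToContinuum-12087),
# line `birth`: stub `stub_goodOfNoBadBond` (G1) — no bad bond nearby ⇒ a `Good(4, θ)` chart

Pure Barlow-stacking geometry.  Fix the reference scale `(a, h)`, `a, h > 0`, and `θ > 0`.  There
are `δ₁ > 0` and `K : ℕ` such that: for every scale `(a', h')` with `|a' − a|, |h' − h| ≤ δ₁`,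
every Hägg word `s`, every rigid motion `w ↦ v + B w` (`B` a linear isometry of `ℝ³`) and every
site `y₀ = v + B (barlowPos a' h' s m i j)` whose layer `m` has no bad bond (`s (k+1) = s k`)
with `|k − m| ≤ K`, the radius-`4` neighbourhood of `y₀` in the image stacking
`(v + B ·) '' barlowStacking a' h' s` is two-way `θ`-matched with
`y₀ + A₂ '' (hcpStacking a h ∩ B̄(0, 4))` for a LINEAR isometry `A₂`.

Proof.  Re-base the word at the site: with `s' = s (· + m)` and `P = barlowPos a' h' s m i j`,
`z ∈ barlowStacking a' h' s ↔ z − P ∈ barlowStacking a' h' s'`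
(`mem_barlowStacking_iff_sub_mem_shift`), so the image stacking is `y₀ + B '' barlowStacking a' h' s'`
and `barlowPos a' h' s' 0 0 0 = 0`.  `PricedHcpWindowsIdealGeometry.matched_of_noBadBond` (with
`R = 4 + θ/2`, `ε = θ/2`, and `δ₁`, `K` as in `stub_unmatchedNearBadBond`) gives an affine
isometry `g` two-way `ε`-matching the `R`-window of `0` in `barlowStacking a' h' s'` with
`g '' hcpStacking a h`.  The base point `0` has an hcp partner `z₀` with `‖g z₀‖ ≤ ε`;
`hcpStacking_homogeneous` at `z₀` gives a linear isometry `Bh` with `q ∈ hcp ↔ z₀ + Bh q ∈ hcp`,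
and `g (z₀ + Bh q) = g z₀ + L (Bh q)` with `L` the linear part of `g`
(`AffineIsometryEquiv.map_vadd`); hence `A₂ := B ∘ L ∘ Bh` works with tolerance `2ε = θ`
(`exists_linearChart_of_matched`).  All `[folklore]`.
-/

noncomputable section

namespace Summit.AtomisticToContinuum.Crystallization.Theorems.HcpLandscapeGapBirth

open Literature.MathematicalPhysics.StatisticalMechanics
open Summit.AtomisticToContinuum.Crystallization.Theorems.PricedHcpWindowsIdealGeometry
  (matched_of_noBadBond)

/-- **A linear chart from an affine matching at the origin.**  If an affine isometry `g` of `ℝ³`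
two-way `ε`-matches the `R`-window of the point `0 ∈ S'` with `g '' hcpStacking a h`
(`0 ≤ ε`, `4 + ε ≤ R`), then for some linear isometry `A` the `4`-window of `0` in `S'` is
two-way `2ε`-matched with `A '' hcpStacking a h`, the partners of the hcp points of norm `≤ 4`
having norm `≤ R + ε`: take the hcp partner `z₀` of `0` (`‖g z₀‖ ≤ ε`), the linear isometry `Bh`
of `hcpStacking_homogeneous` at `z₀`, and `A = L ∘ Bh` with `L` the linear part of `g`, using
`g (z₀ + w) = g z₀ + L w`. [folklore] -/
theorem exists_linearChart_of_matched {a h R ε : ℝ} (hε : 0 ≤ ε) (hR : 4 + ε ≤ R)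
    {S' : Set (EuclideanSpace ℝ (Fin 3))} (h0 : (0 : EuclideanSpace ℝ (Fin 3)) ∈ S')
    {g : EuclideanSpace ℝ (Fin 3) ≃ᵃⁱ[ℝ] EuclideanSpace ℝ (Fin 3)}
    (h1 : ∀ y ∈ S', dist 0 y ≤ R → ∃ z ∈ hcpStacking a h, dist y (g z) ≤ ε)
    (h2 : ∀ z ∈ hcpStacking a h, dist 0 (g z) ≤ R → ∃ y ∈ S', dist y (g z) ≤ ε) :
    ∃ A : EuclideanSpace ℝ (Fin 3) →ₗᵢ[ℝ] EuclideanSpace ℝ (Fin 3),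
      (∀ q ∈ hcpStacking a h, ‖q‖ ≤ 4 → ∃ y ∈ S', ‖y‖ ≤ R + ε ∧ dist y (A q) ≤ 2 * ε) ∧
      (∀ y ∈ S', ‖y‖ ≤ 4 → ∃ q ∈ hcpStacking a h, dist y (A q) ≤ 2 * ε) := by
  -- the hcp partner `z₀` of the base point `0`
  obtain ⟨z₀, hz₀, hd₀⟩ := h1 0 h0 (by rw [dist_self]; linarith)
  rw [dist_zero_left] at hd₀
  -- homogeneity of hcp at `z₀` and the linear part of `g`
  obtain ⟨Bh, hBh⟩ := hcpStacking_homogeneous a h hz₀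
  set L := g.linearIsometryEquiv with hL
  have hg : ∀ w, g (z₀ + w) = g z₀ + L w := fun w => by
    have e := g.map_vadd z₀ w
    simp only [vadd_eq_add] at e
    rw [add_comm z₀ w, e, add_comm]
  have hnear : ∀ w, dist (g (z₀ + w)) (L w) ≤ ε := fun w => by
    rw [hg, dist_add_self_left]
    exact hd₀
  refine ⟨L.toLinearIsometry.comp Bh.toLinearIsometry, ?_, ?_⟩
  · -- an hcp point `q` of norm `≤ 4`: `z₀ + Bh q` is hcp and `g` of it lies in the `R`-window
    intro q hq hq4
    have hzq : z₀ + Bh q ∈ hcpStacking a h := (hBh q).1 hq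
    have hdist : dist 0 (g (z₀ + Bh q)) ≤ R := by
      rw [hg, dist_zero_left]
      calc ‖g z₀ + L (Bh q)‖ ≤ ‖g z₀‖ + ‖L (Bh q)‖ := norm_add_le _ _
        _ = ‖g z₀‖ + ‖q‖ := by rw [L.norm_map, Bh.norm_map]
        _ ≤ R := by linarith
    obtain ⟨y, hy, hyd⟩ := h2 _ hzq hdist
    refine ⟨y, hy, ?_, ?_⟩
    · calc ‖y‖ = dist y 0 := (dist_zero_right y).symm
        _ ≤ dist y (g (z₀ + Bh q)) + dist (g (z₀ + Bh q)) 0 := dist_triangle _ _ _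
        _ ≤ ε + R := add_le_add hyd (by rwa [dist_comm])
        _ = R + ε := add_comm _ _
    · show dist y (L (Bh q)) ≤ 2 * ε
      calc dist y (L (Bh q)) ≤ dist y (g (z₀ + Bh q)) + dist (g (z₀ + Bh q)) (L (Bh q)) :=
            dist_triangle _ _ _
        _ ≤ ε + ε := add_le_add hyd (hnear _)
        _ = 2 * ε := by ring
  · -- a point `y` of `S'` of norm `≤ 4`: its hcp partner `z` reads `z₀ + Bh q`, `q` hcp
    intro y hy hy4
    have hdist : dist 0 y ≤ R := by
      rw [dist_zero_left]
      linarith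
    obtain ⟨z, hz, hzd⟩ := h1 y hy hdist
    refine ⟨Bh.symm (z - z₀), ?_, ?_⟩
    · rw [hBh, LinearIsometryEquiv.apply_symm_apply, add_sub_cancel]
      exact hz
    · show dist y (L (Bh (Bh.symm (z - z₀)))) ≤ 2 * ε
      rw [LinearIsometryEquiv.apply_symm_apply]
      have hgz : g z = g (z₀ + (z - z₀)) := by rw [add_sub_cancel]
      calc dist y (L (z - z₀)) ≤ dist y (g z) + dist (g z) (L (z - z₀)) := dist_triangle _ _ _
        _ ≤ ε + ε := add_le_add hzd (by rw [hgz]; exact hnear _)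
        _ = 2 * ε := by ring

/-- **Stub G1 — no bad bond nearby ⇒ `Good(4, θ)` after a linear isometry.**  For `a, h > 0` and
`θ > 0` there are `δ₁ > 0` and `K : ℕ` (`δ₁ = min (min (a/2) (h/2)) (ε/(2R(1/a + 1/h) + 1))`,
`K = ⌈2(R + ε)/h⌉₊` with `R = 4 + θ/2`, `ε = θ/2`) such that for every scale `(a', h')`,
`a', h' ≠ 0`, `|a' − a|, |h' − h| ≤ δ₁`, every Hägg word `s`, every linear isometry `B`,
translation `v` and indices `(m, i, j)` with no bad bond `s (k+1) = s k`, `|k − m| ≤ K`: for some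
linear isometry `A₂`, with `y₀ = v + B (barlowPos a' h' s m i j)`, (1) every hcp point `q` of norm
`≤ 4` has a point `z` of `(v + B ·) '' barlowStacking a' h' s` with `dist z y₀ ≤ 4 + θ` and
`dist z (y₀ + A₂ q) ≤ θ`, and (2) every point `z` of the image stacking with `dist z y₀ ≤ 4` has
an hcp point `q` with `dist z (y₀ + A₂ q) ≤ θ` (`matched_of_noBadBond` on the re-based word
`s (· + m)` at the origin, `exists_linearChart_of_matched`, transport by `w ↦ y₀ + B w`).
[folklore] -/
theorem stub_goodOfNoBadBond : (∀ (a h : ℝ), 0 < a → 0 < h → ∀ θ : ℝ, 0 < θ → ∃ δ₁ : ℝ, 0 < δ₁ ∧ ∃ K : ℕ, ∀ (a' h' : ℝ), a' ≠ 0 → h' ≠ 0 → |a' - a| ≤ δ₁ → |h' - h| ≤ δ₁ → ∀ s : ℤ → ℤ, Literature.MathematicalPhysics.StatisticalMechanics.IsHaggSeq s → ∀ (B : EuclideanSpace ℝ (Fin 3) →ₗᵢ[ℝ] EuclideanSpace ℝ (Fin 3)) (v : EuclideanSpace ℝ (Fin 3)) (m i j : ℤ), (∀ k : ℤ, |k -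 m| ≤ K → s (k + 1) ≠ s k) → ∃ A₂ : EuclideanSpace ℝ (Fin 3) →ₗᵢ[ℝ] EuclideanSpace ℝ (Fin 3), (∀ q ∈ Literature.MathematicalPhysics.StatisticalMechanics.hcpStacking a h, ‖q‖ ≤ 4 → ∃ z ∈ (fun w => v + B w) '' Literature.MathematicalPhysics.StatisticalMechanics.barlowStacking a' h' s, dist z (v + B (Literature.MathematicalPhysics.StatisticalMechanics.barlowPos a' h' s m i j)) ≤ 4 + θ ∧ dist z ((v + B (Literature.MathematicalPhysics.StatisticalMechanics.barlowPos a' h' s m i j)) + A₂ q) ≤ θ) ∧ (∀ z ∈ (fun w => v + B w) '' Literature.MathematicalPhysics.StatisticalMechanics.barlowStacking a' h' s, dist z (v + B (Literature.MathematicalPhysics.StatisticalMechanics.barlowPos a' h' s m i j)) ≤ 4 → ∃ q ∈ Literature.MathematicalPhysics.StatisticalMechanics.hcpStacking a h, dist z ((v + B (Literature.MathematicalPhysics.StatisticalMechanics.barlowPos a' h' s m i j)) + A₂ q) ≤ θ)) := by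
  intro a h ha hh θ hθ
  -- constants as in `stub_unmatchedNearBadBond`, with `R = 4 + θ/2`, `ε = θ/2`
  set R : ℝ := 4 + θ / 2 with hR
  set ε : ℝ := θ / 2 with hε
  have hε0 : 0 < ε := by positivity
  have hR0 : 0 < R := by positivity
  have hM : 0 ≤ 2 * R * (1 / a + 1 / h) := by positivity
  refine ⟨min (min (a / 2) (h / 2)) (ε / (2 * R * (1 / a + 1 / h) + 1)), by positivity,
    ⌈2 * (R + ε) / h⌉₊, ?_⟩
  intro a' h' ha' hh' haδ hhδ s hs B v m i j hgood
  have hδε : min (min (a / 2) (h / 2)) (ε / (2 * R * (1 / a + 1 / h) + 1)) *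
      (2 * R * (1 / a + 1 / h)) ≤ ε := by
    calc min (min (a / 2) (h / 2)) (ε / (2 * R * (1 / a + 1 / h) + 1)) *
          (2 * R * (1 / a + 1 / h))
        ≤ ε / (2 * R * (1 / a + 1 / h) + 1) * (2 * R * (1 / a + 1 / h)) :=
          mul_le_mul_of_nonneg_right (min_le_right _ _) hM
      _ ≤ ε := by
          rw [div_mul_eq_mul_div, div_le_iff₀ (by positivity)]
          nlinarith
  have hK : R + ε ≤ (⌈2 * (R + ε) / h⌉₊ : ℕ) * (h / 2) := by
    have h1 := Nat.le_ceil (2 * (R + ε) / h)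
    calc R + ε = 2 * (R + ε) / h * (h / 2) := by field_simp
      _ ≤ _ := mul_le_mul_of_nonneg_right h1 (by positivity)
  -- re-base the word at layer `m`: `s' = s (· + m)` has no bad bond within `K` of `0`
  set s' : ℤ → ℤ := fun n => s (n + m) with hs'
  have hs'H : IsHaggSeq s' := isHaggSeq_shift hs m
  have hgood' : ∀ k : ℤ, |k - 0| ≤ (⌈2 * (R + ε) / h⌉₊ : ℕ) → s' (k + 1) ≠ s' k := by
    intro k hk
    have hk' : |k + m - m| ≤ (⌈2 * (R + ε) / h⌉₊ : ℕ) := by rwa [add_sub_cancel_right, ← sub_zero k]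
    have e := hgood (k + m) hk'
    simp only [hs']
    rwa [show k + 1 + m = k + m + 1 by ring]
  obtain ⟨g, hg1, hg2⟩ := matched_of_noBadBond ha hh hε0.le
    ((min_le_left _ _).trans (min_le_left _ _)) ((min_le_left _ _).trans (min_le_right _ _))
    hδε hK ha' hh' haδ hhδ hs'H (m := 0) hgood'
  have hx0 : barlowPos a' h' s' 0 0 0 = 0 := by simp [barlowPos]
  have h0 : (0 : EuclideanSpace ℝ (Fin 3)) ∈ barlowStacking a' h' s' := hx0 ▸ barlowPos_mem 0 0 0
  rw [hx0] at hg1 hg2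
  -- the linear chart at the origin of the re-based stacking
  obtain ⟨A, hA1, hA2⟩ := exists_linearChart_of_matched (a := a) (h := h) hε0.le
    (show 4 + ε ≤ R by rw [hR]) h0 hg1 hg2
  -- transport by the rigid motion `w ↦ y₀ + B w`, `y₀ = v + B P`
  set P := barlowPos a' h' s m i j with hP
  have hΦ : ∀ y, v + B (P + y) = v + B P + B y := fun y => by rw [map_add, add_assoc]
  have hθε : 2 * ε = θ := by rw [hε]; ring
  refine ⟨B.comp A, ?_, ?_⟩
  · intro q hq hq4
    obtain ⟨y, hy, hyR, hyd⟩ := hA1 q hq hq4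
    refine ⟨v + B P + B y, ⟨P + y, ?_, hΦ y⟩, ?_, ?_⟩
    · rw [mem_barlowStacking_iff_sub_mem_shift (m := m) (i₀ := i) (j₀ := j), add_sub_cancel_left]
      exact hy
    · rw [dist_self_add_left, B.norm_map]
      have : R + ε = 4 + θ := by rw [hR, hε]; ring
      linarith
    · rw [LinearIsometry.coe_comp, Function.comp_apply, dist_add_left, B.dist_map, ← hθε]
      exact hyd
  · rintro z ⟨w, hw, rfl⟩ hz4
    dsimp only at hz4 ⊢
    have hy : w - P ∈ barlowStacking a' h' s' :=
      (mem_barlowStacking_iff_sub_mem_shift (m := m) (i₀ := i) (j₀ := j) w).1 hw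
    have hwz : v + B w = v + B P + B (w - P) := by rw [← hΦ, add_sub_cancel]
    rw [hwz, dist_self_add_left, B.norm_map] at hz4
    obtain ⟨q, hq, hqd⟩ := hA2 _ hy hz4
    refine ⟨q, hq, ?_⟩
    rw [hwz, LinearIsometry.coe_comp, Function.comp_apply, dist_add_left, B.dist_map, ← hθε]
    exact hqd

end Summit.AtomisticToContinuum.Crystallization.Theorems.HcpLandscapeGapBirth

end
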